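import Literature.AlgebraicGeometry.Resolution.MacaulayficationKawasakiStepSix
import HarnessLib

/-!
# Kawasaki's interwoven induction, Step 8 (Kawasaki 2000, proof of Thm. 3.1)

Topic: `Literature/AlgebraicGeometry/Resolution`. Brick of the proof of the named facts
`KawasakiMacaulayfication` / `CesnaviciusMacaulayfication`; sequel of
`MacaulayficationKawasakiStepSix.lean`. Step 8 of the printed proof of Kawasaki 2000, Thm. 3.1
(p. 2528): **`(E_{i,i+1})` comes from `(B_{i,i+1})`, `(E_ii)` and `(E_{i+1,i+1})`.**

* `IsPStandard.kawasakiE31_of_ones` — "In the same way as Step 3, we may assume that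
  `nᵢ = ⋯ = nⱼ = 1`": `(E_ij)` follows from `(B_ij)` and its all-exponents-`1` case
  (`Kawasaki.b31_iterate_gen` + Theorem 2.9), for any `i ≤ j` (used again in Step 9);
* `IsPStandard.kawasakiE31_succ_ones` — the all-ones case of `(E_{i,i+1})`, as printed: by
  `(E_ii)` (exponent `2`), `y_ua = xᵢ²b + c`; by `(E_{i+1,i+1})` and the `p`-standard property of
  `xᵢ` on `M/q_{i+1}M`, `b ∈ [(y_{<v},x_Λ)M + q_{i+1}M] : xᵢ² = … : xᵢ`;
* `IsPStandard.kawasakiE31_succ` — `(E_{i,i+1})`.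

Everything is proved; no named fact is introduced.

## References

* [Kawasaki2000] T. Kawasaki, *On Macaulayfication of Noetherian schemes*, Trans. AMS 352 (2000)
  2517–2552, proof of Thm. 3.1, Step 8 (p. 2528).
-/

namespace Literature.AlgebraicGeometry.Resolution

open Ideal Submodule Module IsLocalRing
open scoped Pointwise

universe u v

variable {R : Type u} [CommRing R] [IsLocalRing R] [IsNoetherianRing R]
variable {M : Type v} [AddCommGroup M] [Module R M] [Module.Finite R M]

namespace IsPStandard

variable {xs : List R}

/-- **The two enlarged subsystems of parameters of `(E_ij)`** (Steps 3, 8, 9): if `ys = Y, y_u` is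
a subsystem of parameters of `M/q_{k+1}M`, `k ≤ i`, `m < |ys|` and `L` is a sublist of
`seg xs k i`, then `(ys.take m, L), w` is one of `M/qᵢ₊₁M` for `w = ys[m]`, `w = y_u` and
`w = ys[m]·y_u`, and its entries lie in `𝔪`. [cite: Kawasaki2000, Thm. 3.1, Step 3] -/
theorem isSecantSequence_take_append_sublist (hx : IsPStandard M xs) {i k : ℕ} (hki : k ≤ i)
    {ys Y : List R} {yu : R} (hY : ys = Y ++ [yu]) (hys : IsSecantSequence M (xs.drop k ++ ys))
    (hym : ∀ y ∈ ys, y ∈ maximalIdeal R) {m : ℕ} (hm : m < ys.length) {L : List R}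
    (hL : L.Sublist (seg xs k i)) :
    IsSecantSequence M (xs.drop i ++ ((ys.take m ++ L) ++ [ys[m]])) ∧
      IsSecantSequence M (xs.drop i ++ ((ys.take m ++ L) ++ [yu])) ∧
      IsSecantSequence M (xs.drop i ++ ((ys.take m ++ L) ++ [ys[m] * yu])) ∧
      (∀ z ∈ ys.take m ++ L, z ∈ maximalIdeal R) ∧ yu ∈ maximalIdeal R := by
  classical
  have hS := hx.mem_maximalIdeal_drop_append k hym
  have hdk : xs.drop k = seg xs k i ++ xs.drop i := (seg_append_drop hki).symm
  have hmY : m ≤ Y.length := by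
    rw [hY, List.length_append, List.length_singleton] at hm; omega
  have hTv : (ys.take m ++ [ys[m]]).Sublist ys := by
    rw [← List.take_succ_eq_append_getElem hm]
    exact List.take_sublist _ _
  have hTu : (ys.take m ++ [yu]).Sublist ys := by
    conv_rhs => rw [hY]
    rw [hY, List.take_append_of_le_length hmY]
    exact (List.take_sublist m Y).append (List.Sublist.refl [yu])
  have hWv : IsSecantSequence M (xs.drop i ++ ((ys.take m ++ L) ++ [ys[m]])) := by
    refine hys.of_subperm ⟨L ++ xs.drop i ++ (ys.take m ++ [ys[m]]),
      List.perm_iff_count.mpr fun r => by simp only [List.count_append]; omega, ?_⟩ hS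
    rw [hdk]
    exact (hL.append (List.Sublist.refl _)).append hTv
  have hWu : IsSecantSequence M (xs.drop i ++ ((ys.take m ++ L) ++ [yu])) := by
    refine hys.of_subperm ⟨L ++ xs.drop i ++ (ys.take m ++ [yu]),
      List.perm_iff_count.mpr fun r => by simp only [List.count_append]; omega, ?_⟩ hS
    rw [hdk]
    exact (hL.append (List.Sublist.refl _)).append hTu
  refine ⟨hWv, hWu, ?_, fun z hz => ?_, hym yu (by rw [hY]; simp)⟩
  · rw [← List.append_assoc] at hWv hWu ⊢
    exact hWv.append_mul hWu
  · rcases List.mem_append.mp hz with hz | hz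
    · exact hym z (List.mem_of_mem_take hz)
    · exact hx.mem_maximalIdeal z (List.mem_of_mem_drop ((seg_sublist_drop xs k i).subset (hL.subset hz)))

/-- **"We may assume `nᵢ = ⋯ = nⱼ = 1`" for `(E_ij)`** (Kawasaki 2000, Thm. 3.1, Steps 8 and 9,
"in the same way as Step 3"): `(E_ij)` follows from `(B_ij)` together with its case of all
exponents `1`: both colon modules of `(E_ij)` are
`(∏ q_t^{n_t-1})·{[(y_{<v},x_Λ)M + qᵢ⋯qⱼM] : *} + (y_{<v},x_Λ)M : *` (`Kawasaki.b31_iterate_gen`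
for the subsystems of parameters `y_{<v}, x_Λ, y_vy_u` and `y_{<v}, x_Λ, y_u` of `M/qᵢM`), and
`(y_{<v},x_Λ)M : y_vy_u = (y_{<v},x_Λ)M : y_u` by (2.9.1). [cite: Kawasaki2000, Thm. 3.1, Step 8] -/
theorem kawasakiE31_of_ones (hx : IsPStandard M xs) {i j : ℕ} (hj : j < xs.length)
    (hB : Kawasaki.B31 M xs i j)
    (hones : ∀ k, k ≤ i → ∀ (ys Y : List R) (yu : R), ys = Y ++ [yu] →
      IsSecantSequence M (xs.drop k ++ ys) → (∀ y ∈ ys, y ∈ maximalIdeal R) →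
      KillsParameterColons (M ⧸ (tailIdeal xs k • ⊤ : Submodule R M)) yu →
      ∀ (m : ℕ) (hm : m < ys.length) (L : List R), L.Sublist (seg xs k i) →
        colonBy (ofList (ys.take m ++ L) • ⊤ ⊔ prodPow xs (fun _ => 1) i j • ⊤ : Submodule R M)
            (ys[m] * yu) =
          colonBy (ofList (ys.take m ++ L) • ⊤ ⊔ prodPow xs (fun _ => 1) i j • ⊤ : Submodule R M) yu) :
    Kawasaki.E31 M xs i j := by
  intro n hn k hki ys Y yu hY hys hym hkill m hm L hL
  obtain ⟨_, hWu, hWvu, hWm, hyum⟩ := hx.isSecantSequence_take_append_sublist hki hY hys hym hm hL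
  have hWvum : ∀ z ∈ (ys.take m ++ L) ++ [ys[m] * yu], z ∈ maximalIdeal R := fun z hz => by
    rcases List.mem_append.mp hz with hz | hz
    · exact hWm z hz
    · rw [List.mem_singleton] at hz; rw [hz]
      exact Ideal.mul_mem_left _ _ hyum
  have hWum : ∀ z ∈ (ys.take m ++ L) ++ [yu], z ∈ maximalIdeal R := fun z hz => by
    rcases List.mem_append.mp hz with hz | hz
    · exact hWm z hz
    · rw [List.mem_singleton] at hz; rw [hz]; exact hyum
  have e29 := hx.colonBy_mul_eq_colonBy (X₀ := xs.take k) (D := xs.drop k)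
    (List.take_append_drop k xs).symm hys hym hY (Or.inr hkill) (hL.trans (seg_sublist_drop xs k i)) hm
  rw [Kawasaki.b31_iterate_gen hB hj hWvu hWvum hn, Kawasaki.b31_iterate_gen hB hj hWu hWum hn,
    hones k hki ys Y yu hY hys hym hkill m hm L hL, e29]

/-- **Step 8 of Kawasaki 2000, Thm. 3.1, all exponents `1`**: given `(E_ii)` and `(E_{i+1,i+1})`,
`[(y_{<v},x_Λ)M + qᵢq_{i+1}M] : y_vy_u = [(y_{<v},x_Λ)M + qᵢq_{i+1}M] : y_u`. As printed: by
`(E_ii)` with `nᵢ = 2`, `y_ua = xᵢ²b + c` with `c ∈ (y_{<v},x_Λ)M + qᵢq_{i+1}M`; by `(E_{i+1,i+1})`,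
`xᵢ²b ∈ (y_{<v},x_Λ)M + q_{i+1}M`, so `xᵢb ∈ (y_{<v},x_Λ)M + q_{i+1}M` because `xᵢ` kills the
parameter colons of `M/q_{i+1}M`; hence `y_ua ∈ (y_{<v},x_Λ)M + qᵢq_{i+1}M`.
[cite: Kawasaki2000, Thm. 3.1, Step 8] -/
theorem kawasakiE31_succ_ones (hx : IsPStandard M xs) {i : ℕ} (hi1 : i + 1 < xs.length)
    (hEii : Kawasaki.E31 M xs i i) (hE1 : Kawasaki.E31 M xs (i + 1) (i + 1))
    {k : ℕ} (hki : k ≤ i) {ys Y : List R} {yu : R} (hY : ys = Y ++ [yu])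
    (hys : IsSecantSequence M (xs.drop k ++ ys)) (hym : ∀ y ∈ ys, y ∈ maximalIdeal R)
    (hkill : KillsParameterColons (M ⧸ (tailIdeal xs k • ⊤ : Submodule R M)) yu)
    {m : ℕ} (hm : m < ys.length) {L : List R} (hL : L.Sublist (seg xs k i)) :
    colonBy (ofList (ys.take m ++ L) • ⊤ ⊔ prodPow xs (fun _ => 1) i (i + 1) • ⊤ : Submodule R M)
        (ys[m] * yu) =
      colonBy (ofList (ys.take m ++ L) • ⊤ ⊔ prodPow xs (fun _ => 1) i (i + 1) • ⊤ : Submodule R M)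
        yu := by
  classical
  have hi : i < xs.length := by omega
  have hS := hx.mem_maximalIdeal_drop_append k hym
  -- `Q = qᵢq_{i+1}`, `qᵢ² ⊆ (xᵢ²) + qᵢq_{i+1}`, `Q ⊆ qᵢ²`, `Q ⊆ q_{i+1}`
  have hQ : prodPow xs (fun _ => 1) i (i + 1) = tailIdeal xs i * tailIdeal xs (i + 1) := by
    rw [prodPow_eq_mul _ (Nat.le_succ i), prodPow_self, pow_one, pow_one]
  have hxq : span {xs[i]} ≤ tailIdeal xs i :=
    (Ideal.span_singleton_le_iff_mem _).mpr (getElem_mem_tailIdeal le_rfl hi)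
  have hq2 : tailIdeal xs i ^ 2 ≤ span {xs[i] ^ 2} ⊔ tailIdeal xs i * tailIdeal xs (i + 1) :=
    calc tailIdeal xs i ^ 2 = tailIdeal xs i * (span {xs[i]} ⊔ tailIdeal xs (i + 1)) := by
          rw [pow_two, ← tailIdeal_eq_span_sup hi]
      _ = (span {xs[i]} ⊔ tailIdeal xs (i + 1)) * span {xs[i]} ⊔
            tailIdeal xs i * tailIdeal xs (i + 1) := by
          rw [Ideal.mul_sup, ← tailIdeal_eq_span_sup hi]
      _ ≤ _ := by
          rw [Ideal.sup_mul, Ideal.span_singleton_mul_span_singleton, ← pow_two]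
          exact sup_le (sup_le le_sup_left (le_sup_right.trans'
            ((mul_comm _ _).trans_le (Ideal.mul_mono_left hxq)))) le_sup_right
  refine le_antisymm ?_ (colonBy_le_colonBy_mul _ _ _)
  intro a ha
  -- `(E_ii)` with `nᵢ = 2`: `a ∈ [(W)M + qᵢ²M] : y_vy_u = [(W)M + qᵢ²M] : y_u`
  have ha2 : a ∈ colonBy (ofList (ys.take m ++ L) • ⊤ ⊔ prodPow xs (fun _ => 2) i i • ⊤ :
      Submodule R M) (ys[m] * yu) := by
    refine colonBy_mono (sup_le_sup_left (Submodule.smul_mono_left ?_) _) _ ha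
    rw [prodPow_self, hQ, pow_two]
    exact Ideal.mul_mono_right (tailIdeal_antitone xs (Nat.le_succ i))
  rw [hEii (fun _ => 2) (fun _ _ => Nat.succ_pos 1) k hki ys Y yu hY hys hym hkill m hm L hL,
    mem_colonBy, prodPow_self] at ha2
  -- `y_ua = c + xᵢ²b` with `c ∈ (W)M + qᵢq_{i+1}M`
  have ha2' : yu • a ∈ (ofList (ys.take m ++ L) • ⊤ ⊔ (tailIdeal xs i * tailIdeal xs (i + 1)) • ⊤ :
      Submodule R M) ⊔ span {xs[i] ^ 2} • ⊤ := by
    have hle : (ofList (ys.take m ++ L) • ⊤ ⊔ tailIdeal xs i ^ 2 • ⊤ : Submodule R M) ≤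
        (ofList (ys.take m ++ L) • ⊤ ⊔ (tailIdeal xs i * tailIdeal xs (i + 1)) • ⊤) ⊔
          span {xs[i] ^ 2} • ⊤ := by
      refine sup_le (le_sup_left.trans le_sup_left) ((Submodule.smul_mono_left hq2).trans ?_)
      rw [Submodule.sup_smul]
      exact sup_le le_sup_right (le_sup_left.trans' le_sup_right)
    exact hle ha2
  obtain ⟨c, hc, t, ht, e1⟩ := Submodule.mem_sup.mp ha2'
  obtain ⟨b, -, rfl⟩ := mem_span_singleton_smul_iff.mp ht
  -- `(E_{i+1,i+1})` with `n_{i+1} = 1`: `y_ua ∈ (W)M + q_{i+1}M`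
  have ha3 : a ∈ colonBy (ofList (ys.take m ++ L) • ⊤ ⊔ prodPow xs (fun _ => 1) (i + 1) (i + 1) • ⊤ :
      Submodule R M) (ys[m] * yu) := by
    refine colonBy_mono (sup_le_sup_left (Submodule.smul_mono_left ?_) _) _ ha
    rw [prodPow_self, hQ, pow_one]
    exact Ideal.mul_le_left
  have hL1 : L.Sublist (seg xs k (i + 1)) := by
    rw [seg_succ hki hi]; exact hL.trans (List.sublist_append_left _ _)
  rw [hE1 (fun _ => 1) (Kawasaki.posOn_one _ _) k (by omega) ys Y yu hY hys hym hkill m hm L hL1,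
    mem_colonBy, prodPow_self, pow_one] at ha3
  -- `xᵢ²b ∈ (W)M + q_{i+1}M`, hence `xᵢb ∈ (W)M + q_{i+1}M` (`xᵢ` kills the colons of `M/q_{i+1}M`)
  have hx2b : (xs[i] ^ 2) • b ∈ (ofList (ys.take m ++ L) • ⊤ ⊔ tailIdeal xs (i + 1) • ⊤ :
      Submodule R M) := by
    have e : (xs[i] ^ 2) • b = yu • a - c := by rw [← e1, add_sub_cancel_left]
    rw [e]
    exact Submodule.sub_mem _ ha3 (mem_sup_of_le_right (Submodule.smul_mono_left Ideal.mul_le_left) hc)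
  obtain ⟨hWv, -, -, -, -⟩ := hx.isSecantSequence_take_append_sublist hki hY hys hym hm hL
  have hsec : IsSecantSequence M (xs.drop (i + 1) ++ (ys.take m ++ L) ++ [xs[i]]) := by
    rw [List.append_assoc]
    refine hWv.of_subperm ⟨xs[i] :: (xs.drop (i + 1) ++ (ys.take m ++ L)), ?_, ?_⟩
      (hx.mem_maximalIdeal_drop_append i fun z hz => ?_)
    · exact List.perm_iff_count.mpr fun r => by
        simp only [List.count_append, List.count_cons, List.count_nil]; omega
    · rw [List.drop_eq_getElem_cons hi, List.cons_append]
      exact ((List.Sublist.refl _).append (List.sublist_append_left _ _)).cons_cons xs[i]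
    · rcases List.mem_append.mp hz with hz | hz
      · rcases List.mem_append.mp hz with hz | hz
        · exact hym z (List.mem_of_mem_take hz)
        · exact hx.mem_maximalIdeal z (List.mem_of_mem_drop ((seg_sublist_drop xs k i).subset
            (hL.subset hz)))
      · rw [List.mem_singleton] at hz; rw [hz]
        exact (List.getElem_mem hm |> fun h => hym _ h)
  have hkx : KillsParameterColons (M ⧸ (ofList (xs.drop (i + 1)) • ⊤ : Submodule R M)) xs[i] :=
    hx.kills (xs.take i) xs[i] (xs.drop (i + 1)) (by rw [← List.drop_eq_getElem_cons hi, List.take_append_drop])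
  have hxb : b ∈ colonBy (ofList (xs.drop (i + 1) ++ (ys.take m ++ L)) • ⊤ : Submodule R M) (xs[i] ^ 2) := by
    rw [mem_colonBy, ofList_append_smul, sup_comm]
    exact hx2b
  have hxb' := hkx.colonBy_le_of_quotient (hsec.append_pow (n := 2) Nat.two_pos) hxb
  -- hmm: `colonBy_le_of_quotient` compares the colon by `w = xᵢ²` with the colon by `z = xᵢ`
  rw [mem_colonBy, ofList_append_smul, sup_comm] at hxb'
  -- conclude `y_ua = c + xᵢ(xᵢb) ∈ (W)M + qᵢq_{i+1}M`
  rw [mem_colonBy, ← e1, pow_two, mul_smul, hQ]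
  refine Submodule.add_mem _ hc ?_
  have hle : span {xs[i]} • (ofList (ys.take m ++ L) • ⊤ ⊔ tailIdeal xs (i + 1) • ⊤ : Submodule R M) ≤
      ofList (ys.take m ++ L) • ⊤ ⊔ (tailIdeal xs i * tailIdeal xs (i + 1)) • ⊤ := by
    refine (Submodule.smul_sup _ _ _).le.trans (sup_le_sup Submodule.smul_le_right ?_)
    rw [← Submodule.mul_smul]
    exact Submodule.smul_mono_left (Ideal.mul_mono_left hxq)
  exact hle (Submodule.smul_mem_smul (Ideal.mem_span_singleton_self _) hxb')

/-- **Step 8 of Kawasaki 2000, Thm. 3.1: `(E_{i,i+1})` comes from `(B_{i,i+1})`, `(E_ii)` and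
`(E_{i+1,i+1})`.** [cite: Kawasaki2000, Thm. 3.1, Step 8] -/
theorem kawasakiE31_succ (hx : IsPStandard M xs) {i : ℕ} (hi1 : i + 1 < xs.length)
    (hB : Kawasaki.B31 M xs i (i + 1)) (hEii : Kawasaki.E31 M xs i i)
    (hE1 : Kawasaki.E31 M xs (i + 1) (i + 1)) : Kawasaki.E31 M xs i (i + 1) :=
  hx.kawasakiE31_of_ones hi1 hB fun _ hki _ _ _ hY hys hym hkill _ hm _ hL =>
    hx.kawasakiE31_succ_ones hi1 hEii hE1 hki hY hys hym hkill hm hL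

end IsPStandard

end Literature.AlgebraicGeometry.Resolution
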